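import Summits.QuantumFields.YangMills.Theorems.UnitScaleTiltProp8IterPlaqSmallAllLCluster
import Literature.MathematicalPhysics.QuantumFieldTheory.Balaban1983to89.B10Eq6DensityLevel
import HarnessLib

/-!
# Route `UnitScaleTilt`, crux K1 «MinimiserStabilityRegPr» (stmt-QuantumFields-19200), leaf V2′ — pillar P0 `Localise150`, THE OPEN HALF CLOSED: **k-UNIFORM MULTI-LEVEL
# PLAQUETTE SMALLNESS OF THE (0.4)-DESCENT FOR EVERY BLOCK SIZE `L`, AND `Localise150At L C a` FOR EVERY `L`** (part 2: the recursion-free induction and the carrier)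

Cell `ym3-torus`, seat `ym3-torus-p1` g18 (UV3-NODE §27.7).  THE ARGUMENT (no transport-defect recursion, hence no `L ≥ 7`): fix a plaquette `p′` of `T^{(i)}`, `i ≤ k`;
re-gauge `U` axially from the centre of the first block of `p′` (part 1: the fine bonds under the four corner blocks are then `2d(3Lⁱ−1)a₀`-close to `1`); by
★ym-ust-19200-p2 g6's `Prop8Chart.norm_emlIterU_sub_one_le_of_reads` (p550894) the four bonds of `p′` of the UNGUARDED `i`-fold average are `30ℓLⁱ·s₀`-close to `1`;
by induction over the levels the (0.4) loop guards of the lower averages hold (`LatticeWordStokes.small_of_plaqSmall`), so the unguarded average IS the true one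
(`Prop8Chart.coe_emlIterU_unitsField`); a plaquette is within the sum of its four bond distances of `1`; and the plaquette variables of the true average are gauge
invariant (`T4Continuum.iter_gaugeAct`).  RESULT: `plaqSmall_iter_allL` — `PlaqSmall a₀ U`, `k + 1 ≤ m + K`, budgets `6400ℓ²Lᵏ·2d(3Lᵏ−1)·a₀ ≤ 1` and
`(ℓ²/4)(720dℓ+1)L^{2k}a₀ ≤ 1/50` ⟹ `∀ i ≤ k`, `Ū^{(i)}` is `(720dℓ+1)·L^{2i}·a₀`-small, EVERY `L`; at the d = 3 carrier `plaqSmall_iter_T3_allL` (`10⁷L³ε₀ ≤ 1`,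
constant `10800L + 1`), **`localise150At_allL : ∀ L, Localise150At L (10800L+1) (10⁷L³)⁻¹`** and **`exists_localise150At : ∀ L, 1 < L → ∃ C a, 0 < a ∧ Localise150At L C a`**
— the v8 stub shape of pillar P0 (`stub_localise150`) is a THEOREM (the tree had the `L ≥ 7` half, `Prop8Localise.localise150At_of_ge7`).  Theorems only; NOT a claim about
the mass gap.

References: T. Bałaban, CMP **102** (1985) 277–309 [Balaban1985Variational] ((2), (6) p.278, (145)–(146), (150) p.301); CMP **98** (1985) 17–51 [Balaban1985Averaging]
(Prop. 1 (51) p.26, Prop. 4 (134)–(135) p.38, (9)–(12) p.19); CMP **99** (1985) 75–102 [Balaban1985RegularSpaces] (Lemma 1 p.79).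
-/

noncomputable section

open scoped BigOperators

namespace Summit.QuantumFields.YangMills.Theorems.IterPlaqSmallAllL

open Literature.MathematicalPhysics.QuantumFieldTheory.Balaban1983to89
open T4Continuum BlockAveraging
open B5Eq118OneStroke (iterBlockOf iterBlockOf_succ iterBlockOf_zero)
open B15DeterminingSets (embIter)
open B5Prop12FieldsLattice (distSite)
open B5Eq117TorusCarriers (Mk)
open B5RowSumsP12Lattice (distSite_comm distSite_triangle)
open B7Prop1Explicit (l1)
open B10Eq27TorusAxialLog (rel rel_apply axialT axialT_self gaugeActT gaugeActT_apply holT_one)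
open Literature.MathematicalPhysics.QuantumFieldTheory.BalabanImbrieJaffe1984to88.BIJ88RT51Background (iterBlockOf_embIter)
open Summit.QuantumFields.YangMills.Theorems.Prop7AxialGauge (axialT_gaugeActT)
open Summit.QuantumFields.YangMills.Theorems.Prop7AxialGaugeSup (dist1_mul_inv_le_of_axial)

variable {P : Params}

/-! ## §3 Single plaquettes under the gauge action; the iterated averages in the axial gauge -/

section Main

open scoped Matrix.Norms.L2Operator
open ExpMeanLog LatticeWordStokes
open BlockAveragingEMLProp2 (shift_shift_comm)
open B10Eq27TorusAxialLog (unitsField toUField)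
open Summit.QuantumFields.YangMills.Theorems.Prop8Chart (emlIterU norm_emlIterU_sub_one_le_of_reads coe_emlIterU_unitsField coe_unitsField_toUField)
open Summit.QuantumFields.YangMills.Theorems.IterPlaqSmall (one_div_fifty_lt_deltaSU_fin_two)

variable {G : Type*} [GaugeGroup G]

/-- a single plaquette variable is conjugated by the gauge action: `dist1` is unchanged. [cite: Balaban1985Averaging, (12) p.19] -/
theorem dist1_plaqHol_gaugeAct {j : ℕ} (u : GaugeTransf P j G) (V : GaugeField P j G) (p : Plaq P j) :
    dist1 (GaugeField.plaqHol (GaugeField.gaugeAct u V) p) = dist1 (GaugeField.plaqHol V p) := by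
  have h : GaugeField.plaqHol (GaugeField.gaugeAct u V) p = u p.src * GaugeField.plaqHol V p * (u p.src)⁻¹ := by
    simp only [GaugeField.plaqHol, GaugeField.gaugeAct, PBond.tgt, shift_shift_comm p.src p.μ p.ν, mul_inv_rev, inv_inv]
    group
  rw [h, GaugeGroup.dist1_conj]

variable {k : ℕ}

/-- **ONE LEVEL, ONE PLAQUETTE** (the core step): let `U` have plaquettes within `a₀ > 0` of `1`, `i ≤ k`, `k + 1 ≤ m + K`, and the budget
`6400ℓ²·L^k·(2d(3L^k − 1))·a₀ ≤ 1`.  If the (0.4) loop guards of the iterated averages `Ū^{(i′)}[W]`, `i′ < i`, of the axially gauged field `W = U^{axialT U y}`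
(`y` the centre of the first block of the plaquette `p′`) hold, then the plaquette `p′` of the TRUE `i`-fold average of `U` is within `240dℓ·Lⁱ(3Lⁱ−1)·a₀` of `1`
— for EVERY block size `L`. [cite: Balaban1985Variational, (146) p.301; Balaban1985Averaging, Prop. 4 p.38] -/
theorem dist1_plaqHol_iter_le_of_guards (hk : k + 1 ≤ P.m + P.K) (U : GaugeField P 0 (Matrix.specialUnitaryGroup (Fin 2) ℂ)) {a₀ : ℝ} (ha₀ : 0 < a₀)
    (hU : PlaqSmall a₀ U)
    (hbud : 6400 * (((P.d + 2) * P.L : ℕ) : ℝ) ^ 2 * (P.L : ℝ) ^ k * (2 * ((P.d : ℝ) * (3 * (P.L : ℝ) ^ k - 1)) * a₀) ≤ 1)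
    {i : ℕ} (hi : i ≤ k) (p' : Plaq P i)
    (hguard : ∀ i', i' < i → ∀ c : PBond P (i' + 1),
      Small (expMeanLogSU (n := Fin 2))
        (Averaging.iter (fun j => blockAvg (P := P) (j := j) (expMeanLogSU (n := Fin 2))) i'
          (gaugeActT (axialT U (embIter i p'.src)) U)) c) :
    dist1 (GaugeField.plaqHol (Averaging.iter (fun j => blockAvg (P := P) (j := j) (expMeanLogSU (n := Fin 2))) i U) p') ≤
      240 * (P.d : ℝ) * (((P.d + 2) * P.L : ℕ) : ℝ) * (P.L : ℝ) ^ i * (3 * (P.L : ℝ) ^ i - 1) * a₀ := by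
  set ℓ : ℝ := (((P.d + 2) * P.L : ℕ) : ℝ) with hℓ
  set z := p'.src with hz
  set y := embIter i z with hy
  set u : GaugeTransf P 0 (Matrix.specialUnitaryGroup (Fin 2) ℂ) := axialT U y with hu
  set W := gaugeActT u U with hW
  set s₀ : ℝ := 2 * ((P.d : ℝ) * (3 * (P.L : ℝ) ^ i - 1)) * a₀ with hs₀
  have hi1 : i + 1 ≤ P.m + P.K := by omega
  have hL1 : (1 : ℝ) ≤ P.L := by exact_mod_cast P.L_pos
  have hLi1 : (1 : ℝ) ≤ (P.L : ℝ) ^ i := one_le_pow₀ hL1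
  have hs₀0 : 0 ≤ s₀ := by
    rw [hs₀]
    have hd : (0:ℝ) ≤ P.d := Nat.cast_nonneg _
    have h3 : (0:ℝ) ≤ 3 * (P.L : ℝ) ^ i - 1 := by linarith
    exact mul_nonneg (mul_nonneg (by norm_num) (mul_nonneg hd h3)) ha₀.le
  -- the budget at level `i` from the budget at level `k`
  have hbud_i : 6400 * ℓ ^ 2 * (P.L : ℝ) ^ i * s₀ ≤ 1 := by
    refine le_trans ?_ hbud
    have hpow : (P.L : ℝ) ^ i ≤ (P.L : ℝ) ^ k := pow_le_pow_right₀ hL1 hi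
    have hd : (0 : ℝ) ≤ P.d := Nat.cast_nonneg _
    have h3 : 3 * (P.L : ℝ) ^ i - 1 ≤ 3 * (P.L : ℝ) ^ k - 1 := by linarith
    have h3i : 0 ≤ 3 * (P.L : ℝ) ^ i - 1 := by linarith
    rw [hs₀]
    have : (P.L : ℝ) ^ i * (2 * ((P.d : ℝ) * (3 * (P.L : ℝ) ^ i - 1)) * a₀) ≤ (P.L : ℝ) ^ k * (2 * ((P.d : ℝ) * (3 * (P.L : ℝ) ^ k - 1)) * a₀) :=
      mul_le_mul hpow (by nlinarith [mul_le_mul_of_nonneg_left h3 hd]) (by positivity) (by positivity)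
    nlinarith [sq_nonneg ℓ]
  -- the corners
  set S : Set (Site P i) := {w | w = z ∨ w = z.shift p'.μ ∨ w = z.shift p'.ν ∨ w = (z.shift p'.μ).shift p'.ν} with hS
  -- bonds of `W` under the cluster
  have hWb : ∀ b : PBond P 0, iterBlockOf i b.src ∈ S → iterBlockOf i b.tgt ∈ S →
      ‖((unitsField (toUField W) b : (Matrix (Fin 2) (Fin 2) ℂ)ˣ) : Matrix (Fin 2) (Fin 2) ℂ) - 1‖ ≤ s₀ := by
    intro b hbs hbt
    rw [coe_unitsField_toUField, ← SU2Mean.dist1_eq_norm, hW, hu, hy]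
    exact dist1_axial_cluster_le hi1 U ha₀ hU z p'.μ p'.ν b hbs hbt
  -- the bridge at level `i`: the unguarded iterate of `W` IS its true iterate
  have hbridge := coe_emlIterU_unitsField W i hguard i le_rfl
  -- the four bonds of `p′`
  have hbond : ∀ e : PBond P i, e.src ∈ S → e.tgt ∈ S →
      dist1 (Averaging.iter (fun j => blockAvg (P := P) (j := j) (expMeanLogSU (n := Fin 2))) i W e) ≤ 30 * ℓ * (P.L : ℝ) ^ i * s₀ := by
    intro e hs ht
    rw [SU2Mean.dist1_eq_norm, ← hbridge e]
    exact norm_emlIterU_sub_one_le_of_reads (Nat.le_of_succ_le hi1) S _ hs₀0 hbud_i hWb e hs ht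
  -- the plaquette of the true iterate of `W`, then of `U` by covariance
  have hcov : Averaging.iter (fun j => blockAvg (P := P) (j := j) (expMeanLogSU (n := Fin 2))) i W =
      GaugeField.gaugeAct (transfUp u i) (Averaging.iter (fun j => blockAvg (P := P) (j := j) (expMeanLogSU (n := Fin 2))) i U) := by
    rw [hW, gaugeActT_eq_gaugeAct]; exact iter_gaugeAct _ u i (Nat.le_of_succ_le hi1) U
  rw [← dist1_plaqHol_gaugeAct (transfUp u i), ← hcov]
  refine (Literature.MathematicalPhysics.QuantumFieldTheory.Balaban1983to89.B10Eq6DensityLevel.dist1_plaqHol_le _ p').trans ?_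
  have h1 := hbond ⟨z, p'.μ⟩ (Or.inl rfl) (Or.inr (Or.inl rfl))
  have h2 := hbond ⟨z.shift p'.μ, p'.ν⟩ (Or.inr (Or.inl rfl)) (Or.inr (Or.inr (Or.inr rfl)))
  have h3 := hbond ⟨z.shift p'.ν, p'.μ⟩ (Or.inr (Or.inr (Or.inl rfl))) (Or.inr (Or.inr (Or.inr (shift_shift_comm z p'.ν p'.μ))))
  have h4 := hbond ⟨z, p'.ν⟩ (Or.inl rfl) (Or.inr (Or.inr (Or.inl rfl)))
  simp only [hz] at h1 h2 h3 h4 ⊢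
  have hsum : dist1 (Averaging.iter (fun j => blockAvg (P := P) (j := j) (expMeanLogSU (n := Fin 2))) i W ⟨p'.src, p'.μ⟩) +
      dist1 (Averaging.iter (fun j => blockAvg (P := P) (j := j) (expMeanLogSU (n := Fin 2))) i W ⟨p'.src.shift p'.μ, p'.ν⟩) +
      dist1 (Averaging.iter (fun j => blockAvg (P := P) (j := j) (expMeanLogSU (n := Fin 2))) i W ⟨p'.src.shift p'.ν, p'.μ⟩) +
      dist1 (Averaging.iter (fun j => blockAvg (P := P) (j := j) (expMeanLogSU (n := Fin 2))) i W ⟨p'.src, p'.ν⟩) ≤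
      4 * (30 * ℓ * (P.L : ℝ) ^ i * s₀) := by linarith
  refine hsum.trans (le_of_eq ?_)
  rw [hs₀, hℓ]; ring

/-- **k-UNIFORM MULTI-LEVEL PLAQUETTE SMALLNESS FOR EVERY `L`**: if every plaquette variable of `U` is within `a₀ > 0` of `1`, `k + 1 ≤ m + K`, and the two budgets
`6400ℓ²L^k·2d(3L^k−1)·a₀ ≤ 1`, `(ℓ²/4)·(720dℓ + 1)·L^{2k}·a₀ ≤ 1/50` hold (`1/50 < δ₂`), then for every `i ≤ k` every plaquette variable of the `i`-fold
(0.4)-average `Ū^{(i)}` is within `(720dℓ + 1)·L^{2i}·a₀` of `1` — no block-size threshold (compare `IterPlaqSmall.plaqSmall_iter`, `L ≥ 7`).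
[cite: Balaban1985Variational, (146) p.301; Balaban1985Averaging, Prop. 1 (51) p.26, Prop. 4 p.38] -/
theorem plaqSmall_iter_allL (hk : k + 1 ≤ P.m + P.K) (U : GaugeField P 0 (Matrix.specialUnitaryGroup (Fin 2) ℂ)) {a₀ : ℝ} (ha₀ : 0 < a₀)
    (hU : PlaqSmall a₀ U)
    (hbud : 6400 * (((P.d + 2) * P.L : ℕ) : ℝ) ^ 2 * (P.L : ℝ) ^ k * (2 * ((P.d : ℝ) * (3 * (P.L : ℝ) ^ k - 1)) * a₀) ≤ 1)
    (hguard : ((((P.d + 2) * P.L : ℕ) : ℝ) ^ 2 / 4) * ((720 * (P.d : ℝ) * (((P.d + 2) * P.L : ℕ) : ℝ) + 1) * ((P.L : ℝ) ^ (2 * k) * a₀)) ≤ 1 / 50) :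
    ∀ i, i ≤ k → PlaqSmall ((720 * (P.d : ℝ) * (((P.d + 2) * P.L : ℕ) : ℝ) + 1) * ((P.L : ℝ) ^ (2 * i) * a₀))
      (Averaging.iter (fun j => blockAvg (P := P) (j := j) (expMeanLogSU (n := Fin 2))) i U) := by
  set ℓ : ℝ := (((P.d + 2) * P.L : ℕ) : ℝ) with hℓ
  set C : ℝ := 720 * (P.d : ℝ) * ℓ + 1 with hC
  have hL1 : (1 : ℝ) ≤ P.L := by exact_mod_cast P.L_pos
  have hd0 : (0 : ℝ) ≤ P.d := Nat.cast_nonneg _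
  have hℓ0 : (0 : ℝ) ≤ ℓ := Nat.cast_nonneg _
  -- the statement for all gauge transforms of `U` at once (the axial gauges vary with the plaquette)
  suffices h : ∀ i, i ≤ k → ∀ (v : GaugeTransf P 0 (Matrix.specialUnitaryGroup (Fin 2) ℂ)),
      PlaqSmall (C * ((P.L : ℝ) ^ (2 * i) * a₀))
        (Averaging.iter (fun j => blockAvg (P := P) (j := j) (expMeanLogSU (n := Fin 2))) i (gaugeActT v U)) by
    intro i hi
    have := h i hi (fun _ => 1)
    have h1 : gaugeActT (fun _ => (1 : Matrix.specialUnitaryGroup (Fin 2) ℂ)) U = U := by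
      funext b; simp [gaugeActT]
    rwa [h1] at this
  intro i
  induction i using Nat.strong_induction_on with
  | _ i ih =>
    intro hi v p'
    have hvU : PlaqSmall a₀ (gaugeActT v U) := plaqSmall_gaugeActT v hU
    -- guards of the lower iterates of the axially re-gauged field (a gauge transform of `U` again)
    have hguards : ∀ i', i' < i → ∀ c : PBond P (i' + 1),
        Small (expMeanLogSU (n := Fin 2))
          (Averaging.iter (fun j => blockAvg (P := P) (j := j) (expMeanLogSU (n := Fin 2))) i'
            (gaugeActT (axialT (gaugeActT v U) (embIter i p'.src)) (gaugeActT v U))) c := by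
      intro i' hi' c
      have hcomp : gaugeActT (axialT (gaugeActT v U) (embIter i p'.src)) (gaugeActT v U) =
          gaugeActT (fun x => axialT (gaugeActT v U) (embIter i p'.src) x * v x) U := by
        funext b; simp [gaugeActT, mul_assoc]
      rw [hcomp]
      have hsmall := ih i' hi' (by omega) (fun x => axialT (gaugeActT v U) (embIter i p'.src) x * v x)
      refine small_of_plaqSmall (expMeanLogSU (n := Fin 2)) (by positivity) hsmall ?_ c
      -- `(ℓ²/4)·C·L^{2i′}a₀ ≤ (ℓ²/4)·C·L^{2k}a₀ ≤ 1/50 < δ₂`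
      have hpow : (P.L : ℝ) ^ (2 * i') ≤ (P.L : ℝ) ^ (2 * k) := pow_le_pow_right₀ hL1 (by omega)
      have hδ := one_div_fifty_lt_deltaSU_fin_two
      rw [expMeanLogSU_δ, Fintype.card_fin]
      rw [deltaSU, Fintype.card_fin] at hδ
      refine lt_of_le_of_lt ?_ hδ
      refine le_trans ?_ hguard
      have hC0 : 0 ≤ C := by positivity
      have : C * ((P.L : ℝ) ^ (2 * i') * a₀) ≤ C * ((P.L : ℝ) ^ (2 * k) * a₀) :=
        mul_le_mul_of_nonneg_left (mul_le_mul_of_nonneg_right hpow ha₀.le) hC0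
      exact mul_le_mul_of_nonneg_left this (by positivity)
    have hmain := dist1_plaqHol_iter_le_of_guards hk (gaugeActT v U) ha₀ hvU hbud hi p' hguards
    refine hmain.trans_lt ?_
    -- `240dℓ·Lⁱ(3Lⁱ−1)a₀ < (720dℓ + 1)·L^{2i}·a₀`
    have hLi : (0 : ℝ) < (P.L : ℝ) ^ i := by positivity
    have hsq : (P.L : ℝ) ^ (2 * i) = (P.L : ℝ) ^ i * (P.L : ℝ) ^ i := by rw [two_mul, pow_add]
    rw [hsq]
    nlinarith [mul_pos hLi hLi, mul_pos (mul_pos hLi hLi) ha₀, mul_nonneg (mul_nonneg hd0 hℓ0) (mul_nonneg hLi.le ha₀.le)]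

end Main

/-! ## §4 At the d = 3 carrier: the multi-level smallness and PILLAR P0 FOR EVERY `L` -/

section T3

open scoped Matrix.Norms.L2Operator
open ExpMeanLog T3ContinuumYM3Torus T3RegularMinimiser
open Summit.QuantumFields.YangMills.Theorems.Prop8Localise (Localise150At localCriticality_of_isCritR2)

/-- **AT THE d = 3 CARRIER, EVERY `L`**: if every plaquette variable of `U` is within `ε₀L^{−2(K−n)}` of `1` (`regThreshold`), `0 < ε₀` and `10⁷·L³·ε₀ ≤ 1`, then for every
`i ≤ K − n` the `i`-fold (0.4)-average is `(10800L + 1)·ε₀·L^{2i}·L^{−2(K−n)}`-small (compare `IterPlaqSmall.plaqSmall_iter_T3`, which needs `L ≥ 7`).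
[cite: Balaban1985Variational, (2) p.278 and (146) p.301] -/
theorem plaqSmall_iter_T3_allL (F : T3Family) (n K : ℕ) {ε₀ : ℝ} (hε₀ : 0 < ε₀) (hε : 10 ^ 7 * (F.L : ℝ) ^ 3 * ε₀ ≤ 1)
    (U : GaugeField (F.P K) 0 (Matrix.specialUnitaryGroup (Fin 2) ℂ)) (hU : PlaqSmall (regThreshold F n K ε₀) U) :
    ∀ i, i ≤ K - n → PlaqSmall ((10800 * (F.L : ℝ) + 1) * ((F.L : ℝ) ^ (2 * i) * regThreshold F n K ε₀))
      (Averaging.iter (fun j => blockAvg (P := F.P K) (j := j) (expMeanLogSU (n := Fin 2))) i U) := by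
  intro i hik
  have hd : (F.P K).d = 3 := T3Family.P_d F K
  have hLL : ((F.P K).L : ℝ) = F.L := rfl
  have hL3 : 3 ≤ F.L := by obtain ⟨a, ha⟩ := F.hL.1; have := F.hL.2; omega
  have hL3r : (3 : ℝ) ≤ F.L := by exact_mod_cast hL3
  have hL0 : (0 : ℝ) < F.L := by linarith
  have hreg0 : 0 < regThreshold F n K ε₀ := by unfold regThreshold; positivity
  have hk1 : K - n + 1 ≤ (F.P K).m + (F.P K).K := by
    show K - n + 1 ≤ F.m + K; have := F.hm; omega
  have hpow : ((F.P K).L : ℝ) ^ (2 * (K - n)) * regThreshold F n K ε₀ = ε₀ := by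
    rw [hLL, regThreshold, inv_pow, mul_comm, mul_assoc, inv_mul_cancel₀ (pow_ne_zero _ hL0.ne'), mul_one]
  have hpowk : ((F.P K).L : ℝ) ^ (K - n) * (((F.P K).L : ℝ) ^ (K - n) * regThreshold F n K ε₀) = ε₀ := by
    rw [← mul_assoc, ← pow_add, ← two_mul, hpow]
  -- budget 1: `6400ℓ²L^k·2d(3L^k−1)·a₀ ≤ 38400·d·ℓ²·ε₀ = 2 880 000 L² ε₀ ≤ 1`
  have hbud : 6400 * ((((F.P K).d + 2) * (F.P K).L : ℕ) : ℝ) ^ 2 * ((F.P K).L : ℝ) ^ (K - n) *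
      (2 * (((F.P K).d : ℝ) * (3 * ((F.P K).L : ℝ) ^ (K - n) - 1)) * regThreshold F n K ε₀) ≤ 1 := by
    rw [hd]; push_cast; rw [hLL]
    have hLk : (1 : ℝ) ≤ (F.L : ℝ) ^ (K - n) := one_le_pow₀ (by linarith)
    have h1 : 6400 * (5 * (F.L : ℝ)) ^ 2 * (F.L : ℝ) ^ (K - n) * (2 * ((3 : ℝ) * (3 * (F.L : ℝ) ^ (K - n) - 1)) * regThreshold F n K ε₀) ≤
        6400 * (5 * (F.L : ℝ)) ^ 2 * (2 * 3 * 3) * ((F.L : ℝ) ^ (K - n) * ((F.L : ℝ) ^ (K - n) * regThreshold F n K ε₀)) := by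
      nlinarith [mul_pos (pow_pos hL0 (K - n)) hreg0, sq_nonneg (F.L : ℝ)]
    rw [hLL] at hpowk
    rw [hpowk] at h1
    refine h1.trans ?_
    have hL2 : (F.L : ℝ) ^ 2 ≤ (F.L : ℝ) ^ 3 := pow_le_pow_right₀ (by linarith) (by norm_num)
    nlinarith
  -- budget 2: `(ℓ²/4)(720dℓ+1)L^{2k}a₀ = (25L²/4)(10800L+1)ε₀ ≤ 1/50`
  have hguard : (((((F.P K).d + 2) * (F.P K).L : ℕ) : ℝ) ^ 2 / 4) *
      ((720 * ((F.P K).d : ℝ) * ((((F.P K).d + 2) * (F.P K).L : ℕ) : ℝ) + 1) * (((F.P K).L : ℝ) ^ (2 * (K - n)) * regThreshold F n K ε₀)) ≤ 1 / 50 := by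
    rw [hpow, hd]; push_cast; rw [hLL]
    have hL1 : (1 : ℝ) ≤ F.L := by linarith
    have h1 : (F.L : ℝ) ≤ (F.L : ℝ) ^ 3 := le_self_pow₀ hL1 (by norm_num)
    have h2 : (F.L : ℝ) ^ 2 ≤ (F.L : ℝ) ^ 3 := pow_le_pow_right₀ hL1 (by norm_num)
    nlinarith [sq_nonneg (F.L : ℝ), mul_pos hL0 hε₀]
  have h := plaqSmall_iter_allL hk1 U hreg0 hU hbud hguard i hik
  rw [hd] at h
  push_cast at h
  rw [hLL] at h
  refine IterPlaqSmall.plaqSmall_mono (le_of_eq ?_) h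
  ring

/-- **PILLAR P0 `Localise150` FOR EVERY BLOCK SIZE**: `Localise150At L (10800L + 1) (10⁷L³)⁻¹` for EVERY `L` — conjunct (i) by `plaqSmall_iter_T3_allL`, conjunct (ii) by
`Prop8Localise.localCriticality_of_isCritR2`; the `L ≥ 7` restriction of `Prop8Localise.localise150At_of_ge7` is gone, so the v8 stub
`stub_localise150 : ∀ L, 1 < L → ∃ C a, 0 < a ∧ Localise150At L C a` is a theorem (`exists_localise150At`). [cite: Balaban1985Variational, (146) and (150) p.301] -/
theorem localise150At_allL (L : ℕ) : Localise150At L (10800 * (L : ℝ) + 1) (10 ^ 7 * (L : ℝ) ^ 3)⁻¹ := by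
  intro F hF n K hnK ε₀ hε₀ hε₀a V U hreg _ hcrit
  subst hF
  refine ⟨fun i hik => ?_, fun D _ => localCriticality_of_isCritR2 F hnK hcrit D⟩
  have hL0 : (0 : ℝ) < F.L := by exact_mod_cast F.hL.2.le
  have hε : 10 ^ 7 * (F.L : ℝ) ^ 3 * ε₀ ≤ 1 := by
    have hpos : (0 : ℝ) < 10 ^ 7 * (F.L : ℝ) ^ 3 := by positivity
    calc 10 ^ 7 * (F.L : ℝ) ^ 3 * ε₀ ≤ 10 ^ 7 * (F.L : ℝ) ^ 3 * (10 ^ 7 * (F.L : ℝ) ^ 3)⁻¹ := mul_le_mul_of_nonneg_left hε₀a hpos.le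
      _ = 1 := mul_inv_cancel₀ hpos.ne'
  exact plaqSmall_iter_T3_allL F n K hε₀ hε U hreg.plaqSmall i hik

/-- **THE v8 STUB SHAPE OF P0, AS A THEOREM**: `∀ L, 1 < L → ∃ C a, 0 < a ∧ Localise150At L C a`. [cite: Balaban1985Variational, (146) and (150) p.301] -/
theorem exists_localise150At (L : ℕ) (hL : 1 < L) : ∃ (C a : ℝ), 0 < a ∧ Localise150At L C a :=
  ⟨_, _, by
    have hL0 : (0 : ℝ) < L := by exact_mod_cast (by omega : 0 < L)
    exact inv_pos.mpr (mul_pos (by norm_num) (pow_pos hL0 3)), localise150At_allL L⟩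

end T3

end Summit.QuantumFields.YangMills.Theorems.IterPlaqSmallAllL

end
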